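import Summits.QuantumFields.YangMills.Theorems.SwapVirialDeficitBlowUpGnomonicDeficitDefs
import HarnessLib

/-!
# THE VIRIAL IDENTITY in the gnomonic blow-up chart (file B of the V2′ assembly of fcl-p3 g45's virial SPEC, memo2-24197-window v2 §2′):
# `b·∫ (XF̂)·e^{−bF̂}·ρ = ∫ (N − W)·e^{−bF̂}·ρ` on every fibre `(a, ε)`, `N = 7 + 3|Fol L| = 18L⁴ − 2 = 2α`
# (free-hands support of ⟨stmt-QuantumFields-24197⟩ `SwapVirialDeficit.SwapGluedStiffness`)

Instantiating the Euler-field integration by parts ✓`integral_eulerDeriv_mul_gnoDensity` (A2) at the Gibbs factor `g = e^{−bF̂}` of the σ-glued deficit in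
gnomonic coordinates `F̂ = gnoDeficit z χ a ε` (B0), whose flow derivative is `−b·XF̂·e^{−bF̂}` with `|XF̂| ≤ 324L⁴` (w2 g57's S-B ✓`hasDerivAt_chartDeficit_gnomonic_le`
through ✓`hasDerivAt_gnoDeficit`):
* §1 `measurable_exp_gnoDeficit`, `abs_exp_gnoDeficit_le_one`, ★ `hasDerivAt_exp_gnoDeficit` (flow derivative of the Gibbs factor), its measurability and bound;
* §2 ★★★ `virial_fibre` — for every hub `a ≠ 0`, signs `ε`, sector `z`, character `χ` and `b ≥ 0`:
  `b · ∫ XF̂·e^{−bF̂}·ρ dη = ∫ (N − gnoW)·e^{−bF̂}·ρ dη` over `GnoCoord L` (`ρ = gnoDensity`);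
* §3 `mul_exp_neg_mul_le` (`x e^{−bx} ≤ b⁻¹`), integrability of `F̂e^{−bF̂}ρ`, `XF̂e^{−bF̂}ρ`, `We^{−bF̂}ρ`, and ★★ `virial_decomposition` (`b > 0`):
  `b·∫ F̂e^{−bF̂}ρ = (N/2)·∫ e^{−bF̂}ρ − ½·∫ gnoW·e^{−bF̂}ρ + b·∫ (F̂ − ½XF̂)·e^{−bF̂}ρ` — the memo's (V3′) `b⟨F⟩_b = α − ½⟨W⟩_b + b⟨R⟩_b` on each fibre before
  normalisation, with the REMAINDER `R = F̂ − ½XF̂` (third order at the flat locus) and the second-order weight `W = gnoW ≥ 0` isolated exactly.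
What this is for: summed over `ε` and integrated against `coneMeasure` in `a` (the joint gnomonic ring chart, G1-joint) it gives the ring identity
`b⟨F⟩_b = α − ½⟨W⟩_b + b⟨R⟩_b`, reducing ⟨24197⟩'s window row to `b⟨R⟩_b − ½⟨W⟩_b ≥ −1/2 + c`, i.e. to UNIFORM-IN-`L` local moment bounds (V4′) — OPEN.
HONEST LABEL: an exact identity at fixed `L` on each chart fibre; no estimate; ⟨24197⟩ (window-uniform) ∕ ⟨24194⟩ ∕ ⟨24196⟩ ∕ ⟨24497⟩ OPEN; the Yang–Mills mass
gap is NOT proved; no summit is proved by a line.  Seat ym-line-fcl-p3 g46 (cell ym-idea-1, free hands; item of record ⟨24085⟩ aside, untouched),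
`--supports stmt-QuantumFields-24197`.  THEOREMS ONLY, 0 `sorry`, standard axioms (no local instances needed).  References: [cite: Luscher1983, §2]; [folklore]
(virial ∕ Euler identity by scaling).
-/

set_option autoImplicit false
set_option synthInstance.maxSize 1024

noncomputable section

open MeasureTheory Quaternion Set Filter Topology
open scoped Quaternion BigOperators
open Literature.MathematicalPhysics.QuantumLattice
open Literature.MathematicalPhysics.QuantumFieldTheory hiding SU2
open Summit.QuantumFields.YangMills.Theorems.FemtoTransferGap
open Summit.QuantumFields.YangMills.Theorems.FemtoTransferGap.TT

namespace Summit.QuantumFields.YangMills.Theorems.SwapVirialDeficit.BlowUpRing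

variable {L : ℕ} [NeZero L]

/-! ## §1 The Gibbs factor `e^{−bF̂}` along the Euler flow -/

section Gibbs

variable (z : Fin 3 → Bool) (χ : Site 3 L → SU2) (a : ℍ) (ε : GnoSign L) (b : ℝ)

/-- `e^{−bF̂}` is measurable in `η`. [folklore] -/
theorem measurable_exp_gnoDeficit : Measurable fun η : GnoCoord L => Real.exp (-(b * gnoDeficit z χ a ε η)) :=
  (((measurable_gnoDeficit z χ a ε).const_mul b).neg).exp

variable {b}

/-- `0 < e^{−bF̂} ≤ 1` for `b ≥ 0`. [folklore] -/
theorem exp_gnoDeficit_le_one (hb : 0 ≤ b) (η : GnoCoord L) : Real.exp (-(b * gnoDeficit z χ a ε η)) ≤ 1 :=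
  Real.exp_le_one_iff.2 (by have := gnoDeficit_nonneg z χ a ε η; nlinarith)

/-- `|e^{−bF̂}| ≤ 1` for `b ≥ 0`. [folklore] -/
theorem abs_exp_gnoDeficit_le_one (hb : 0 ≤ b) (η : GnoCoord L) : |Real.exp (-(b * gnoDeficit z χ a ε η))| ≤ 1 := by
  rw [abs_of_pos (Real.exp_pos _)]; exact exp_gnoDeficit_le_one z χ a ε hb η

variable {a}

/-- ★ **The flow derivative of the Gibbs factor**: `d/ds|₀ e^{−bF̂(eulerDilate eˢ η)} = −b·XF̂(η)·e^{−bF̂(η)}` (hub `a ≠ 0`). [folklore] -/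
theorem hasDerivAt_exp_gnoDeficit (ha : a ≠ 0) (η : GnoCoord L) :
    HasDerivAt (fun s : ℝ => Real.exp (-(b * gnoDeficit z χ a ε (eulerDilate (Real.exp s) η))))
      (-(b * gnoXDeficit z χ a ε η) * Real.exp (-(b * gnoDeficit z χ a ε η))) 0 := by
  have h := (((hasDerivAt_gnoDeficit z χ ha ε η).1.const_mul b).fun_neg).exp
  refine h.congr_deriv ?_
  rw [Real.exp_zero, eulerDilate_one, mul_comm]

/-- The flow derivative of the Gibbs factor is measurable in `η`. [folklore] -/
theorem measurable_XexpGnoDeficit (ha : a ≠ 0) :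
    Measurable fun η : GnoCoord L => -(b * gnoXDeficit z χ a ε η) * Real.exp (-(b * gnoDeficit z χ a ε η)) :=
  (((measurable_gnoXDeficit z χ ha ε).const_mul b).neg).mul (measurable_exp_gnoDeficit z χ a ε b)

/-- … and bounded by `b·324L⁴` (`b ≥ 0`). [cite: Luscher1983, §2] -/
theorem abs_XexpGnoDeficit_le (ha : a ≠ 0) (hb : 0 ≤ b) (η : GnoCoord L) :
    |-(b * gnoXDeficit z χ a ε η) * Real.exp (-(b * gnoDeficit z χ a ε η))| ≤ b * (324 * (L : ℝ) ^ 4) := by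
  rw [abs_mul, abs_neg, abs_mul, abs_of_nonneg hb]
  have h1 := abs_gnoXDeficit_le z χ ha ε η
  have h2 := abs_exp_gnoDeficit_le_one z χ a ε hb η
  have h0 : 0 ≤ b * |gnoXDeficit z χ a ε η| := mul_nonneg hb (abs_nonneg _)
  calc b * |gnoXDeficit z χ a ε η| * |Real.exp (-(b * gnoDeficit z χ a ε η))| ≤ b * (324 * (L : ℝ) ^ 4) * 1 :=
        mul_le_mul (mul_le_mul_of_nonneg_left h1 hb) h2 (abs_nonneg _) (by positivity)
    _ = b * (324 * (L : ℝ) ^ 4) := mul_one _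

end Gibbs

/-! ## §2 The virial identity on a chart fibre -/

/-- ★★★ **THE VIRIAL IDENTITY IN THE GNOMONIC BLOW-UP CHART** (memo2-24197-window §2′ (V2′), on each fibre `(a, ε)` of the chart): for a hub `a ≠ 0`,
signs `ε`, sector `z`, character `χ` and every `b ≥ 0`,
`b · ∫ XF̂(η)·e^{−bF̂(η)}·ρ(η) dη = ∫ (N − gnoW(η))·e^{−bF̂(η)}·ρ(η) dη`, `N = 7 + 3|Fol L| = 18L⁴ − 2`
— integration by parts for the joint blow-up's Euler field against the gnomonic density, NO boundary term (✓`integral_eulerDeriv_mul_gnoDensity` at `g = e^{−bF̂}`,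
flow derivative ✓`hasDerivAt_exp_gnoDeficit`, speed bound S-B). [folklore] -/
theorem virial_fibre (z : Fin 3 → Bool) (χ : Site 3 L → SU2) {a : ℍ} (ha : a ≠ 0) (ε : GnoSign L) {b : ℝ} (hb : 0 ≤ b) :
    b * ∫ η : GnoCoord L, gnoXDeficit z χ a ε η * Real.exp (-(b * gnoDeficit z χ a ε η)) * gnoDensity η =
      ∫ η : GnoCoord L, ((7 + 3 * (Fintype.card (Fol L) : ℝ)) - gnoW η) * Real.exp (-(b * gnoDeficit z χ a ε η)) * gnoDensity η := by
  have key := integral_eulerDeriv_mul_gnoDensity (L := L) (g := fun η => Real.exp (-(b * gnoDeficit z χ a ε η)))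
    (Xg := fun η => -(b * gnoXDeficit z χ a ε η) * Real.exp (-(b * gnoDeficit z χ a ε η)))
    (measurable_exp_gnoDeficit z χ a ε b) (M := 1) (abs_exp_gnoDeficit_le_one z χ a ε hb) (fun η => hasDerivAt_exp_gnoDeficit z χ ε ha η)
    (measurable_XexpGnoDeficit z χ ε ha) (M' := b * (324 * (L : ℝ) ^ 4)) (abs_XexpGnoDeficit_le z χ ε ha hb)
  have e1 : ∫ η : GnoCoord L, -(b * gnoXDeficit z χ a ε η) * Real.exp (-(b * gnoDeficit z χ a ε η)) * gnoDensity η =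
      -(b * ∫ η : GnoCoord L, gnoXDeficit z χ a ε η * Real.exp (-(b * gnoDeficit z χ a ε η)) * gnoDensity η) := by
    rw [← integral_const_mul, ← integral_neg]
    refine integral_congr_ae (ae_of_all _ fun η => ?_)
    ring
  have e2 : ∫ η : GnoCoord L, Real.exp (-(b * gnoDeficit z χ a ε η)) * ((gnoW η - (7 + 3 * (Fintype.card (Fol L) : ℝ))) * gnoDensity η) =
      -∫ η : GnoCoord L, ((7 + 3 * (Fintype.card (Fol L) : ℝ)) - gnoW η) * Real.exp (-(b * gnoDeficit z χ a ε η)) * gnoDensity η := by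
    rw [← integral_neg]
    refine integral_congr_ae (ae_of_all _ fun η => ?_)
    ring
  rw [e1, e2] at key
  linarith

/-- ★★★ The same with the dilated dimension written as `18L⁴ − 2 = 2α` (✓`two_alpha_eq`). [folklore] -/
theorem virial_fibre' (z : Fin 3 → Bool) (χ : Site 3 L → SU2) {a : ℍ} (ha : a ≠ 0) (ε : GnoSign L) {b : ℝ} (hb : 0 ≤ b) :
    b * ∫ η : GnoCoord L, gnoXDeficit z χ a ε η * Real.exp (-(b * gnoDeficit z χ a ε η)) * gnoDensity η =
      ∫ η : GnoCoord L, (((18 * L ^ 4 - 2 : ℕ) : ℝ) - gnoW η) * Real.exp (-(b * gnoDeficit z χ a ε η)) * gnoDensity η := by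
  rw [virial_fibre z χ ha ε hb, ← two_alpha_eq, cast_seven_add]

/-! ## §3 Integrability of the pieces and the virial decomposition `b∫F̂e^{−bF̂}ρ = (N/2)∫e^{−bF̂}ρ − ½∫We^{−bF̂}ρ + b∫Re^{−bF̂}ρ` -/

/-- `x·e^{−bx} ≤ b⁻¹` for `b > 0` (from `y + 1 ≤ e^y`). [folklore] -/
theorem mul_exp_neg_mul_le (x : ℝ) {b : ℝ} (hb : 0 < b) : x * Real.exp (-(b * x)) ≤ b⁻¹ := by
  have h1 : b * x ≤ Real.exp (b * x) := by have := Real.add_one_le_exp (b * x); linarith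
  have hE : Real.exp (b * x) * Real.exp (-(b * x)) = 1 := by rw [← Real.exp_add, add_neg_cancel, Real.exp_zero]
  have h2 : x * Real.exp (-(b * x)) * b ≤ 1 := by
    calc x * Real.exp (-(b * x)) * b = (b * x) * Real.exp (-(b * x)) := by ring
      _ ≤ Real.exp (b * x) * Real.exp (-(b * x)) := mul_le_mul_of_nonneg_right h1 (Real.exp_pos _).le
      _ = 1 := hE
  rwa [inv_eq_one_div, le_div_iff₀ hb]

section Pieces

variable (z : Fin 3 → Bool) (χ : Site 3 L → SU2) {a : ℍ} (ε : GnoSign L) {b : ℝ}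

/-- `e^{−bF̂}·ρ` is integrable (`b ≥ 0`). [folklore] -/
theorem integrable_exp_gnoDeficit_mul (a : ℍ) (hb : 0 ≤ b) :
    Integrable fun η : GnoCoord L => Real.exp (-(b * gnoDeficit z χ a ε η)) * gnoDensity η := by
  refine Integrable.mono' integrable_gnoDensity ((measurable_exp_gnoDeficit z χ a ε b).mul measurable_gnoDensity).aestronglyMeasurable
    (ae_of_all _ fun η => ?_)
  rw [Real.norm_eq_abs, abs_mul, abs_of_pos (gnoDensity_pos η)]
  exact (mul_le_mul_of_nonneg_right (abs_exp_gnoDeficit_le_one z χ a ε hb η) (gnoDensity_pos η).le).trans (by rw [one_mul])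

/-- `F̂·e^{−bF̂}·ρ` is integrable (`b > 0`; `F̂e^{−bF̂} ≤ b⁻¹`). [folklore] -/
theorem integrable_gnoDeficit_exp_mul (a : ℍ) (hb : 0 < b) :
    Integrable fun η : GnoCoord L => gnoDeficit z χ a ε η * Real.exp (-(b * gnoDeficit z χ a ε η)) * gnoDensity η := by
  refine Integrable.mono' (integrable_gnoDensity.const_mul b⁻¹)
    (((measurable_gnoDeficit z χ a ε).mul (measurable_exp_gnoDeficit z χ a ε b)).mul measurable_gnoDensity).aestronglyMeasurable
    (ae_of_all _ fun η => ?_)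
  have h0 : 0 ≤ gnoDeficit z χ a ε η * Real.exp (-(b * gnoDeficit z χ a ε η)) := mul_nonneg (gnoDeficit_nonneg z χ a ε η) (Real.exp_pos _).le
  rw [Real.norm_eq_abs, abs_mul, abs_of_pos (gnoDensity_pos η), abs_of_nonneg h0]
  exact mul_le_mul_of_nonneg_right (mul_exp_neg_mul_le _ hb) (gnoDensity_pos η).le

/-- `XF̂·e^{−bF̂}·ρ` is integrable (hub `a ≠ 0`, `b ≥ 0`; `|XF̂| ≤ 324L⁴`). [folklore] -/
theorem integrable_gnoXDeficit_exp_mul (ha : a ≠ 0) (hb : 0 ≤ b) :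
    Integrable fun η : GnoCoord L => gnoXDeficit z χ a ε η * Real.exp (-(b * gnoDeficit z χ a ε η)) * gnoDensity η := by
  refine Integrable.mono' (integrable_gnoDensity.const_mul (324 * (L : ℝ) ^ 4))
    (((measurable_gnoXDeficit z χ ha ε).mul (measurable_exp_gnoDeficit z χ a ε b)).mul measurable_gnoDensity).aestronglyMeasurable
    (ae_of_all _ fun η => ?_)
  rw [Real.norm_eq_abs, abs_mul, abs_mul, abs_of_pos (gnoDensity_pos η)]
  have h1 := abs_gnoXDeficit_le z χ ha ε η
  have h2 := abs_exp_gnoDeficit_le_one z χ a ε hb η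
  have h3 : |gnoXDeficit z χ a ε η| * |Real.exp (-(b * gnoDeficit z χ a ε η))| ≤ 324 * (L : ℝ) ^ 4 * 1 :=
    mul_le_mul h1 h2 (abs_nonneg _) (by positivity)
  rw [mul_one] at h3
  exact mul_le_mul_of_nonneg_right h3 (gnoDensity_pos η).le

/-- `gnoW·e^{−bF̂}·ρ` is integrable (`b ≥ 0`; `0 ≤ gnoW ≤ 4(3 + |Fol L|)`). [folklore] -/
theorem integrable_gnoW_exp_mul (a : ℍ) (hb : 0 ≤ b) :
    Integrable fun η : GnoCoord L => gnoW η * Real.exp (-(b * gnoDeficit z χ a ε η)) * gnoDensity η := by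
  refine Integrable.mono' (integrable_gnoDensity.const_mul (4 * (3 + (Fintype.card (Fol L) : ℝ))))
    ((measurable_gnoW.mul (measurable_exp_gnoDeficit z χ a ε b)).mul measurable_gnoDensity).aestronglyMeasurable (ae_of_all _ fun η => ?_)
  obtain ⟨hW0, hW1⟩ := gnoW_nonneg_le η
  rw [Real.norm_eq_abs, abs_mul, abs_mul, abs_of_pos (gnoDensity_pos η), abs_of_nonneg hW0]
  have h2 := abs_exp_gnoDeficit_le_one z χ a ε hb η
  have h3 : gnoW η * |Real.exp (-(b * gnoDeficit z χ a ε η))| ≤ 4 * (3 + (Fintype.card (Fol L) : ℝ)) * 1 := mul_le_mul hW1 h2 (abs_nonneg _) (by positivity)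
  rw [mul_one] at h3
  exact mul_le_mul_of_nonneg_right h3 (gnoDensity_pos η).le

end Pieces

/-- ★★ **THE VIRIAL DECOMPOSITION on a chart fibre** (memo2-24197-window §2′ (V3′), before normalisation): for a hub `a ≠ 0`, signs `ε`, and `b > 0`,
`b·∫ F̂e^{−bF̂}ρ = (N/2)·∫ e^{−bF̂}ρ − ½·∫ gnoW·e^{−bF̂}ρ + b·∫ (F̂ − ½XF̂)·e^{−bF̂}ρ`, `N = 7 + 3|Fol L| = 2α`
— dividing by the fibre mass `∫ e^{−bF̂}ρ` this reads `b⟨F̂⟩_b = α − ½⟨W⟩_b + b⟨R⟩_b` with the remainder `R = F̂ − ½XF̂`. [folklore] -/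
theorem virial_decomposition (z : Fin 3 → Bool) (χ : Site 3 L → SU2) {a : ℍ} (ha : a ≠ 0) (ε : GnoSign L) {b : ℝ} (hb : 0 < b) :
    b * ∫ η : GnoCoord L, gnoDeficit z χ a ε η * Real.exp (-(b * gnoDeficit z χ a ε η)) * gnoDensity η =
      (7 + 3 * (Fintype.card (Fol L) : ℝ)) / 2 * (∫ η : GnoCoord L, Real.exp (-(b * gnoDeficit z χ a ε η)) * gnoDensity η)
        - 1 / 2 * (∫ η : GnoCoord L, gnoW η * Real.exp (-(b * gnoDeficit z χ a ε η)) * gnoDensity η)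
        + b * (∫ η : GnoCoord L, (gnoDeficit z χ a ε η - gnoXDeficit z χ a ε η / 2) * Real.exp (-(b * gnoDeficit z χ a ε η)) * gnoDensity η) := by
  have hV := virial_fibre z χ ha ε hb.le
  have iF := integrable_gnoDeficit_exp_mul z χ ε a hb
  have iX := integrable_gnoXDeficit_exp_mul z χ ε ha hb.le
  have iW := integrable_gnoW_exp_mul z χ ε a hb.le
  have iE := integrable_exp_gnoDeficit_mul z χ ε a hb.le
  -- split the remainder integral
  have eR : ∫ η : GnoCoord L, (gnoDeficit z χ a ε η - gnoXDeficit z χ a ε η / 2) * Real.exp (-(b * gnoDeficit z χ a ε η)) * gnoDensity η =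
      (∫ η : GnoCoord L, gnoDeficit z χ a ε η * Real.exp (-(b * gnoDeficit z χ a ε η)) * gnoDensity η)
        - 1 / 2 * ∫ η : GnoCoord L, gnoXDeficit z χ a ε η * Real.exp (-(b * gnoDeficit z χ a ε η)) * gnoDensity η := by
    rw [← integral_const_mul, ← integral_sub iF (iX.const_mul _)]
    refine integral_congr_ae (ae_of_all _ fun η => ?_)
    ring
  -- split the virial right-hand side
  have eV : ∫ η : GnoCoord L, ((7 + 3 * (Fintype.card (Fol L) : ℝ)) - gnoW η) * Real.exp (-(b * gnoDeficit z χ a ε η)) * gnoDensity η =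
      (7 + 3 * (Fintype.card (Fol L) : ℝ)) * (∫ η : GnoCoord L, Real.exp (-(b * gnoDeficit z χ a ε η)) * gnoDensity η)
        - ∫ η : GnoCoord L, gnoW η * Real.exp (-(b * gnoDeficit z χ a ε η)) * gnoDensity η := by
    rw [← integral_const_mul, ← integral_sub (iE.const_mul _) iW]
    refine integral_congr_ae (ae_of_all _ fun η => ?_)
    ring
  rw [eV] at hV
  rw [eR]
  linarith

end Summit.QuantumFields.YangMills.Theorems.SwapVirialDeficit.BlowUpRing

end
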